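import Literature.MathematicalPhysics.QuantumManyBody.GroundStateFeynmanKac
import Literature.Probability.Process.BrownianPair
import Literature.Probability.Process.PathRegularization
import HarnessLib

/-!
# Ground-state Feynman–Kac: the Markov property of the `3N` world-lines and the semigroup law

Topic `Literature/MathematicalPhysics/QuantumManyBody`; theorems only (no new definition, no named
fact). First step of the proof of the named fact
`Literature.MathematicalPhysics.QuantumManyBody.BoseGas.GroundStateFeynmanKac`
(`GroundStateFeynmanKac.lean`): the **weak Markov property at deterministic times** of the `3N`
independent canonical Brownian coordinates `wienerPaths N` driving the world-lines, and its first
consequence, the **semigroup (Chapman–Kolmogorov) law of the Feynman–Kac functional**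

  `fkSemigroup v L (s + t) g = fkSemigroup v L s (fkSemigroup v L t g)`   (pointwise, `s, t ≥ 0`),

i.e. `e^{-(s+t)H_N} = e^{-sH_N} e^{-tH_N}` evaluated path-wise (Chung–Zhao, *From Brownian Motion
to Schrödinger's Equation* (1995), §3.2, the computation preceding Theorem 3.10:
`T_{s+t}f = E^x{e_q(s) [e_q(t) f(X_t)] ∘ θ_s} = E^x{e_q(s) E^{X_s}[e_q(t) f(X_t)]} = T_s(T_t f)`).

* `indepFun_pi_map` — independence is preserved under finite products of probability spaces
  (Kallenberg (2002), Lemma 3.10), the `Measure.pi` version of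
  `Literature.Probability.Process.indepFun_prodMap`.
* `indepFun_pathsShift_pathsPast`, `map_pathsShift_eq`, `map_pathsPath_eq`,
  `lintegral_comp_pathsShift_eq` — the weak Markov property of `wienerPaths N`: the family of
  shifted paths `(b_{s+u}(ω i k) - b_s(ω i k))_{u}` is independent of the family of pasts
  `(b_u(ω i k))_{u ≤ s}` and has the law of the family of paths, whence the factorisation of
  expectations `E[G(ξ, θ_s ω)] = E[ω ↦ ∫ G(ξ ω, b(ω')) dW(ω')]` for past-measurable `ξ`.
* Raw-path functionals: the world-lines, the survival event, the action and the weight as honest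
  measurable functionals of RAW paths through `Literature.Probability.Process.pathRegularize`
  (the identity on continuous paths), their identification on Brownian / shifted / stopped paths,
  and the splitting of the weight at time `s`.
* `fkSemigroup_add` — the semigroup law.

## References

* K. L. Chung, Z. Zhao, *From Brownian Motion to Schrödinger's Equation*, Grundlehren 312,
  Springer (1995), §3.2 (the Feynman–Kac semigroup; semigroup property from the Markov property)
  and §3.3 (3.34). [ChungZhao1995]
* O. Kallenberg, *Foundations of Modern Probability* (2002), Lemma 3.10, Thm 13.5.
* D. Revuz, M. Yor, *Continuous Martingales and Brownian Motion* (1999), Ch. III §1 (simple Markov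
  property).
-/

noncomputable section

open MeasureTheory ProbabilityTheory Filter Set
open scoped ENNReal NNReal Topology

namespace Literature.MathematicalPhysics.QuantumManyBody.BoseGas

open Literature.Probability.Process

/-! ### Independence across finite products of probability spaces -/

/-- **Independent pairs stay independent across a finite product.** If `f i ⟂ g i` under `μ i`
for every `i`, then the families `(f i ∘ eval i)_i` and `(g i ∘ eval i)_i` are independent under
`Measure.pi μ` (check the product formula on the generating π-systems of boxes).
Kallenberg, *Foundations of Modern Probability* (2002), Lemma 3.10. [folklore] -/
theorem indepFun_pi_map {ι : Type*} [Fintype ι] {Ω α β : ι → Type*}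
    [∀ i, MeasurableSpace (Ω i)] [∀ i, MeasurableSpace (α i)] [∀ i, MeasurableSpace (β i)]
    {μ : ∀ i, Measure (Ω i)} [∀ i, IsProbabilityMeasure (μ i)]
    {f : ∀ i, Ω i → α i} {g : ∀ i, Ω i → β i} (hfg : ∀ i, IndepFun (f i) (g i) (μ i))
    (hf : ∀ i, Measurable (f i)) (hg : ∀ i, Measurable (g i)) :
    IndepFun (fun (ω : ∀ i, Ω i) (i : ι) => f i (ω i)) (fun (ω : ∀ i, Ω i) (i : ι) => g i (ω i))
      (Measure.pi μ) := by
  classical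
  set F : (∀ i, Ω i) → ∀ i, α i := fun ω i => f i (ω i) with hFdef
  set G : (∀ i, Ω i) → ∀ i, β i := fun ω i => g i (ω i) with hGdef
  have hF : Measurable F := measurable_pi_lambda _ fun i => (hf i).comp (measurable_pi_apply i)
  have hG : Measurable G := measurable_pi_lambda _ fun i => (hg i).comp (measurable_pi_apply i)
  set pα : Set (Set (∀ i, α i)) :=
    Set.pi univ '' Set.pi univ fun i => {s : Set (α i) | MeasurableSet s} with hpα
  set pβ : Set (Set (∀ i, β i)) :=
    Set.pi univ '' Set.pi univ fun i => {s : Set (β i) | MeasurableSet s} with hpβ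
  have hπα : IsPiSystem pα := isPiSystem_pi
  have hπβ : IsPiSystem pβ := isPiSystem_pi
  have hgenα : MeasurableSpace.comap F MeasurableSpace.pi =
      MeasurableSpace.generateFrom {s | ∃ t ∈ pα, F ⁻¹' t = s} := by
    rw [← generateFrom_pi, MeasurableSpace.comap_generateFrom]
    rfl
  have hgenβ : MeasurableSpace.comap G MeasurableSpace.pi =
      MeasurableSpace.generateFrom {s | ∃ t ∈ pβ, G ⁻¹' t = s} := by
    rw [← generateFrom_pi, MeasurableSpace.comap_generateFrom]
    rfl
  rw [IndepFun_iff_Indep]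
  refine IndepSets.indep hF.comap_le hG.comap_le (hπα.comap _) (hπβ.comap _) hgenα hgenβ ?_
  rw [IndepSets_iff]
  rintro _ _ ⟨_, ⟨S, hS, rfl⟩, rfl⟩ ⟨_, ⟨T, hT, rfl⟩, rfl⟩
  simp only [Set.mem_pi, Set.mem_univ, forall_const, mem_setOf_eq] at hS hT
  have h1 : F ⁻¹' Set.pi univ S = Set.pi univ fun i => f i ⁻¹' S i := by
    ext ω; simp [hFdef]
  have h2 : G ⁻¹' Set.pi univ T = Set.pi univ fun i => g i ⁻¹' T i := by
    ext ω; simp [hGdef]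
  rw [h1, h2, ← Set.pi_inter_distrib, Measure.pi_pi, Measure.pi_pi, Measure.pi_pi,
    ← Finset.prod_mul_distrib]
  exact Finset.prod_congr rfl fun i _ => (hfg i).measure_inter_preimage_eq_mul _ _ (hS i) (hT i)

/-! ### The weak Markov property of the `3N` Brownian coordinates -/

section Markov

variable (N : ℕ)

/-- The shifted-path map `ω ↦ ((b_{s+u}(ω i k) - b_s(ω i k))_u)_{i,k}` is measurable. [folklore] -/
theorem measurable_pathsShift (s : ℝ≥0) :
    Measurable fun (ω : PathSpace N) (i : Fin N) (k : Fin 3) (u : ℝ≥0) =>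
      brownian (s + u) (ω i k) - brownian s (ω i k) := by
  refine measurable_pi_lambda _ fun i => measurable_pi_lambda _ fun k => ?_
  exact (measurable_shift s).comp ((measurable_pi_apply k).comp (measurable_pi_apply i))

/-- The path map `ω ↦ ((b_u(ω i k))_u)_{i,k}` is measurable. [folklore] -/
theorem measurable_pathsPath :
    Measurable fun (ω : PathSpace N) (i : Fin N) (k : Fin 3) (u : ℝ≥0) => brownian u (ω i k) := by
  refine measurable_pi_lambda _ fun i => measurable_pi_lambda _ fun k => ?_
  exact measurable_path.comp ((measurable_pi_apply k).comp (measurable_pi_apply i))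

/-- The past map `ω ↦ ((b_u(ω i k))_{u ≤ s})_{i,k}` is measurable. [folklore] -/
theorem measurable_pathsPast (s : ℝ≥0) :
    Measurable fun (ω : PathSpace N) (i : Fin N) (k : Fin 3) (u : Set.Iic s) =>
      brownian u (ω i k) := by
  refine measurable_pi_lambda _ fun i => measurable_pi_lambda _ fun k => ?_
  exact (measurable_past s).comp ((measurable_pi_apply k).comp (measurable_pi_apply i))

/-- **Weak Markov property of the `3N` Brownian coordinates, independence part**: the family of
shifted paths after time `s` is independent of the family of pasts up to time `s` (Mathlib's
`IsPreBrownianReal.indepFun_shift` in each coordinate, combined across the product measure by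
`indepFun_pi_map`, twice). Revuz–Yor (1999), Ch. III §1; Kallenberg (2002), Thm 13.5 with
Lemma 3.10. [folklore] -/
theorem indepFun_pathsShift_pathsPast (s : ℝ≥0) :
    IndepFun (fun (ω : PathSpace N) (i : Fin N) (k : Fin 3) (u : ℝ≥0) =>
        brownian (s + u) (ω i k) - brownian s (ω i k))
      (fun (ω : PathSpace N) (i : Fin N) (k : Fin 3) (u : Set.Iic s) => brownian u (ω i k))
      (wienerPaths N) := by
  haveI := Literature.Probability.RandomPlanarGeometry.isProbabilityMeasure_preWienerMeasure'
  have h1 : IndepFun (fun (ω₁ : ℝ≥0 → ℝ) (u : ℝ≥0) => brownian (s + u) ω₁ - brownian s ω₁)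
      (fun (ω₁ : ℝ≥0 → ℝ) (u : Set.Iic s) => brownian u ω₁) preWienerMeasure :=
    Literature.Probability.RandomPlanarGeometry.isPreBrownianReal_brownian.indepFun_shift s
  have h3 : IndepFun (fun (η : Fin 3 → ℝ≥0 → ℝ) (k : Fin 3) (u : ℝ≥0) =>
        brownian (s + u) (η k) - brownian s (η k))
      (fun (η : Fin 3 → ℝ≥0 → ℝ) (k : Fin 3) (u : Set.Iic s) => brownian u (η k))
      (Measure.pi fun _ : Fin 3 => preWienerMeasure) :=
    indepFun_pi_map (fun _ => h1) (fun _ => measurable_shift s) (fun _ => measurable_past s)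
  exact indepFun_pi_map (μ := fun _ : Fin N => Measure.pi fun _ : Fin 3 => preWienerMeasure)
    (fun _ => h3)
    (fun _ => measurable_pi_lambda _ fun k => (measurable_shift s).comp (measurable_pi_apply k))
    (fun _ => measurable_pi_lambda _ fun k => (measurable_past s).comp (measurable_pi_apply k))

/-- **The law of the family of continuous paths is `wienerPaths N` itself** (coordinate-wise
`map_path_preWienerMeasure`, through `Measure.pi_map_pi` twice). [folklore] -/
theorem map_pathsPath_eq :
    (wienerPaths N).map (fun (ω : PathSpace N) (i : Fin N) (k : Fin 3) (u : ℝ≥0) =>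
      brownian u (ω i k)) = wienerPaths N := by
  haveI := Literature.Probability.RandomPlanarGeometry.isProbabilityMeasure_preWienerMeasure'
  have h3 : (Measure.pi fun _ : Fin 3 => preWienerMeasure).map
      (fun (η : Fin 3 → ℝ≥0 → ℝ) (k : Fin 3) (u : ℝ≥0) => brownian u (η k)) =
      Measure.pi fun _ : Fin 3 => preWienerMeasure := by
    rw [Measure.pi_map_pi (fun _ => measurable_path.aemeasurable)]
    simp_rw [map_path_preWienerMeasure]
  unfold wienerPaths
  rw [Measure.pi_map_pi (f := fun (_ : Fin N) (η : Fin 3 → ℝ≥0 → ℝ) (k : Fin 3) (u : ℝ≥0) =>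
    brownian u (η k))
    (fun _ => (measurable_pi_lambda _ fun k => measurable_path.comp
      (measurable_pi_apply k)).aemeasurable)]
  simp_rw [h3]

/-- **Weak Markov property of the `3N` Brownian coordinates, law part**: the family of shifted
paths has the law of the family of paths, i.e. `wienerPaths N` (coordinate-wise
`map_shift_eq_map_path`). Revuz–Yor (1999), Ch. III §1. [folklore] -/
theorem map_pathsShift_eq (s : ℝ≥0) :
    (wienerPaths N).map (fun (ω : PathSpace N) (i : Fin N) (k : Fin 3) (u : ℝ≥0) =>
      brownian (s + u) (ω i k) - brownian s (ω i k)) = wienerPaths N := by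
  haveI := Literature.Probability.RandomPlanarGeometry.isProbabilityMeasure_preWienerMeasure'
  have h3 : (Measure.pi fun _ : Fin 3 => preWienerMeasure).map
      (fun (η : Fin 3 → ℝ≥0 → ℝ) (k : Fin 3) (u : ℝ≥0) => brownian (s + u) (η k) - brownian s (η k)) =
      Measure.pi fun _ : Fin 3 => preWienerMeasure := by
    rw [Measure.pi_map_pi (fun _ => (measurable_shift s).aemeasurable)]
    simp_rw [map_shift_eq_map_path, map_path_preWienerMeasure]
  conv_rhs => rw [wienerPaths]
  rw [wienerPaths, Measure.pi_map_pi (f := fun (_ : Fin N) (η : Fin 3 → ℝ≥0 → ℝ) (k : Fin 3)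
    (u : ℝ≥0) => brownian (s + u) (η k) - brownian s (η k))
    (fun _ => (measurable_pi_lambda _ fun k => (measurable_shift s).comp
      (measurable_pi_apply k)).aemeasurable)]
  simp_rw [h3]

/-- **Markov factorisation of expectations for the `3N` Brownian coordinates.** For a nonnegative
jointly measurable `G`, a random variable `ξ` measurable with respect to the past
`σ(b_u(ω i k) : u ≤ s, i, k)` and the family of shifted paths
`θ_s ω = ((b_{s+u}(ω i k) - b_s(ω i k))_u)_{i,k}`:
`E[G(ξ, θ_s)] = E[ω ↦ ∫ G(ξ ω, b(ω')) dW(ω')]` (independence of `θ_s` from the past and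
`law(θ_s) = law(b) = W`). The many-coordinate analogue of
`Literature.Probability.Process.lintegral_comp_shift_eq`; the form of the simple Markov property
behind the semigroup law of the Feynman–Kac functional. Revuz–Yor (1999), Ch. III §1;
Chung–Zhao (1995), §3.2. [folklore] -/
theorem lintegral_comp_pathsShift_eq {X : Type*} [MeasurableSpace X] (s : ℝ≥0)
    {ξ : PathSpace N → X}
    (hξ : Measurable[MeasurableSpace.comap (fun (ω : PathSpace N) (i : Fin N) (k : Fin 3)
      (u : Set.Iic s) => brownian u (ω i k)) inferInstance] ξ)
    {G : X × PathSpace N → ℝ≥0∞} (hG : Measurable G) :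
    ∫⁻ ω, G (ξ ω, fun i k u => brownian (s + u) (ω i k) - brownian s (ω i k)) ∂wienerPaths N =
      ∫⁻ ω, ∫⁻ ω', G (ξ ω, fun i k u => brownian u (ω' i k)) ∂wienerPaths N ∂wienerPaths N := by
  have hξm : Measurable ξ := hξ.mono (measurable_pathsPast N s).comap_le le_rfl
  have hind : IndepFun ξ (fun (ω : PathSpace N) (i : Fin N) (k : Fin 3) (u : ℝ≥0) =>
      brownian (s + u) (ω i k) - brownian s (ω i k)) (wienerPaths N) := by
    have h := indepFun_pathsShift_pathsPast N s
    rw [IndepFun_iff_Indep] at h ⊢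
    exact (indep_of_indep_of_le_right h (measurable_iff_comap_le.1 hξ)).symm
  have hlaw : (wienerPaths N).map (fun ω => (ξ ω, fun i k u =>
      brownian (s + u) (ω i k) - brownian s (ω i k))) =
      ((wienerPaths N).map ξ).prod ((wienerPaths N).map fun (ω : PathSpace N) (i : Fin N)
        (k : Fin 3) (u : ℝ≥0) => brownian (s + u) (ω i k) - brownian s (ω i k)) :=
    (indepFun_iff_map_prod_eq_prod_map_map hξm.aemeasurable
      (measurable_pathsShift N s).aemeasurable).1 hind
  calc ∫⁻ ω, G (ξ ω, fun i k u => brownian (s + u) (ω i k) - brownian s (ω i k)) ∂wienerPaths N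
      = ∫⁻ p, G p ∂((wienerPaths N).map fun ω => (ξ ω, fun i k u =>
          brownian (s + u) (ω i k) - brownian s (ω i k))) := by
        rw [lintegral_map hG (hξm.prodMk (measurable_pathsShift N s))]
    _ = ∫⁻ p, G p ∂(((wienerPaths N).map ξ).prod ((wienerPaths N).map fun (ω : PathSpace N)
          (i : Fin N) (k : Fin 3) (u : ℝ≥0) => brownian (s + u) (ω i k) - brownian s (ω i k))) := by
        rw [hlaw]
    _ = ∫⁻ x, ∫⁻ w, G (x, w) ∂((wienerPaths N).map fun (ω : PathSpace N) (i : Fin N) (k : Fin 3)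
          (u : ℝ≥0) => brownian (s + u) (ω i k) - brownian s (ω i k)) ∂((wienerPaths N).map ξ) :=
        lintegral_prod _ hG.aemeasurable
    _ = ∫⁻ x, ∫⁻ w, G (x, w) ∂(wienerPaths N) ∂((wienerPaths N).map ξ) := by
        rw [map_pathsShift_eq]
    _ = ∫⁻ x, ∫⁻ ω', G (x, fun i k u => brownian u (ω' i k)) ∂wienerPaths N
          ∂((wienerPaths N).map ξ) := by
        congr 1
        funext x
        have hGx : Measurable fun w => G (x, w) := hG.comp (measurable_const.prodMk measurable_id)
        conv_lhs => rw [← map_pathsPath_eq N]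
        rw [lintegral_map hGx (measurable_pathsPath N)]
    _ = ∫⁻ ω, ∫⁻ ω', G (ξ ω, fun i k u => brownian u (ω' i k)) ∂wienerPaths N ∂wienerPaths N := by
        have hF : Measurable fun x => ∫⁻ ω', G (x, fun i k u => brownian u (ω' i k))
            ∂wienerPaths N :=
          (hG.comp (measurable_fst.prodMk ((measurable_pathsPath N).comp
            measurable_snd))).lintegral_prod_right'
        rw [lintegral_map hF hξm]

end Markov

end Literature.MathematicalPhysics.QuantumManyBody.BoseGas

end
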